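import Summits.BirchSwinnertonDyer.BirchSwinnertonDyer.Theses.CMKolyvaginAtInertTwo
import Summits.BirchSwinnertonDyer.BirchSwinnertonDyer.Theorems.CMKolyvaginAtInertTwoExactSumDefectLeOneAtTwo
import HarnessLib

/-! Scratch (bsd-line-cmk2-p1 g21): the DECIDING THEOREM of route CMKolyvaginAtInertTwo RE-CERTIFIED for the restatement R1′ — kernel check that
the restated items compose to the leaf `Summit.BirchSwinnertonDyer.WAllCornerFTwo` exactly as today's `closes` does (companion of
`TURNKEY_route_edit_24277_onebit.lean`, whose decl texts are repeated here verbatim).  ITEMS AFTER THE EDIT (proposal; the pen decides, D-0059):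
* crux `CMKolyvaginExactAtInertTwoOneBitRestated` (24277 VERBATIM + «Σ ≤ 1» after the Heegner hypothesis) with its CLOSABLE twin
  `CMKolyvaginExactAtInertTwoOneBitRestatedOfFacts` (antecedent: the four prints ∧ the print `Prop37ReductionCongruenceInertAll` below; closer =
  `KolyvaginLowerTwo.cmKolyvaginExactAtInertTwo_of_sum_defect_le_one_of_printedInputs`, p758017, kernel-checked again below);
* support `Prop37ReductionCongruenceInertAll` (Gross 1991 Prop. 3.7 (2) = Literature `GrossLMS1991.prop37_2_reductionCongruence_inert`, BY NAME,
  quantified over `(W, K)` — PRINT, cite-only, like 19273 / 24148 / 24149);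
* crux `CMPrimitiveSupplyAtInertTwoOneBitRestated` (24276 VERBATIM + «Σ ≤ 1» on the supplied `K`) — OPEN: its old closer 24649 (Hoffstein–Luo)
  does not control Σ; a Σ = 1 / prime-twist non-vanishing print for the class is Silverman-conjecture territory (RESTATE-24277.md v2);
  the old `CMKolyvaginConjectureAtInertTwo` 24648 stays its research input;
* unchanged: `CMExactDescentAtTwoOfFacts` 24154 (closed), `OffHabitatCMResidualAtTwo` 22838, `CMRankZeroBSDTriple` 19423, `EntireLFunctionRat`
  19273, `GrossZagierAllLevels` 24148, `MultPublishedInputsAtTwo` 19921, `MilneAnyModel` 24149.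
`closes_onebit` below uses every binder.  BSD is not proved by any of this; nothing here is filed or closed by name. -/

namespace Scratch.CMKolyvaginAtInertTwoClosesOneBit

open Summit.BirchSwinnertonDyer.BirchSwinnertonDyer.Theses.CMKolyvaginAtInertTwo
open Summit.BirchSwinnertonDyer.BirchSwinnertonDyer.Theorems

/-- PROPOSED RESTATEMENT R1′ of crux 24277 (verbatim copy of `TURNKEY_route_edit_24277_onebit.lean`). -/
def CMKolyvaginExactAtInertTwoOneBitRestated : Prop :=
  ∀ (W : WeierstrassCurve ℚ) [W.IsElliptic] [W.IsGloballyMinimal] [NeZero (W.conductorNorm ℤ)], W.HasCM → Literature.NumberTheory.EllipticCurves.Rank1Residual.CMInert W 2 → W.HasSurjectiveModNGaloisRep (2 : ℤ) → Odd W.tamagawaProduct → ∀ (K : Type) [Field K] [NumberField K], Literature.NumberTheory.EllipticCurves.IsImaginaryQuadratic K → Odd (NumberField.discr K) → NumberField.discr K ≠ -3 → Literature.NumberTheory.EllipticCurves.SatisfiesHeegnerHypothesis (W.conductorNorm ℤ) K → (∑ q ∈ (NumberField.discr K).natAbs.primeFactors, ((if jacobiSym W.Δ.num q = -1 then 1 else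 0) + (if jacobiSym W.Δ.num q = 1 ∧ Even (W.frobeniusTrace q) then 2 else 0)) ≤ 1) → ¬ IsSquare ((NumberField.discr K : ℚ) * -|W.Δ|) → ¬ IsSquare ((NumberField.discr K : ℚ) * (-(2 * |W.Δ|))) → ∀ (Dt : Literature.NumberTheory.EllipticCurves.ModularForms.ModularParametrizationData W (W.conductorNorm ℤ)) (β : ℤ) (ι : K →+* ℂ) (d₁ : Literature.NumberTheory.EllipticCurves.KolyvaginHeegnerData Dt β ι 1), ¬ IsOfFinAddOrder d₁.derivedPoint → ∀ (M₀ : ℕ), (∃ Q : (W.baseChange (Literature.NumberTheory.EllipticCurves.ringClassField K ι 1)).toAffine.Point, ((2 ^ M₀ : ℕ) : ℤ) • Q = d₁.derivedPoint) → (¬ ∃ Q : (W.baseChange (Literature.NumberTheory.EllipticCurves.ringClassField K ι 1)).toAffine.Point, ((2 ^ (M₀ + 1) : ℕ) : ℤ) • Q = d₁.derivedPoint) → ∀ (n : ℕ) (d : Literature.NumberTheory.EllipticCurves.KolyvaginHeegnerData Dt β ι n), Squarefree n → (∀ ℓ ∈ n.primeFactors, (Literature.NumberTheory.EllipticCurves.Zhang2014.IsKolyvaginPrime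 (W.conductorNorm ℤ) W K 2 ℓ ∧ Literature.NumberTheory.EllipticCurves.Rank1Residual.CMInert W ℓ)) → (¬ ∃ Q : (W.baseChange (Literature.NumberTheory.EllipticCurves.ringClassField K ι n)).toAffine.Point, (2 : ℤ) • Q = d.derivedPoint) → Nat.card (AddCommGroup.primaryComponent (W.baseChange K).sha 2) = 2 ^ (2 * M₀)

/-- PROPOSED support item (PRINT, cite-only): Gross 1991 Prop. 3.7 (2) BY NAME for every `(W, K)`. -/
def Prop37ReductionCongruenceInertAll : Prop :=
  ∀ (W : WeierstrassCurve ℚ) [W.IsElliptic] [W.IsGloballyMinimal] [NeZero (W.conductorNorm ℤ)] (K : Type) [Field K] [NumberField K],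
    Literature.NumberTheory.EllipticCurves.GrossLMS1991.prop37_2_reductionCongruence_inert (W.conductorNorm ℤ) W K

/-- `…OfFacts` twin of (R1′): the four prints ∧ `Prop37ReductionCongruenceInertAll` ⟹ the restated crux. -/
def CMKolyvaginExactAtInertTwoOneBitRestatedOfFacts : Prop :=
  (((∀ (N : ℕ) [NeZero N] (W : WeierstrassCurve ℚ) (K : Type) [Field K] [NumberField K],
      Literature.NumberTheory.EllipticCurves.gross_zagier N W K) ∧
    Literature.NumberTheory.EllipticCurves.rank_eq_analyticRank_of_analyticRank_le_one ∧
    WeierstrassCurve.hasEntireLFunction_rat ∧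
    Literature.NumberTheory.EllipticCurves.Milne1972.bsdQuotient_baseChange_quadratic_anyModel) ∧
    Prop37ReductionCongruenceInertAll) →
  CMKolyvaginExactAtInertTwoOneBitRestated

/-- THE CLOSER of the `…OfFacts` twin, BY NAME (p758017). -/
theorem cmKolyvaginExactAtInertTwoOneBitRestatedOfFacts_proof : CMKolyvaginExactAtInertTwoOneBitRestatedOfFacts := by
  rintro ⟨⟨hGZ, hGZK, hmod, hMi⟩, h37⟩ W _ _ _ hCM hin hρ hT K _ _ hK hodd h3 hH hdef hs1 hs2 Dt β ι d₁ hy M₀ hdiv hndiv n d hn hKoly hPn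
  exact KolyvaginLowerTwo.cmKolyvaginExactAtInertTwo_of_sum_defect_le_one_of_printedInputs W hCM hin hρ hT K hK hodd h3 hH hs1 hs2 Dt β ι
    d₁ hy M₀ hdiv hndiv n d hn hKoly hPn hdef (h37 W K) hGZ hGZK hmod hMi

/-- PROPOSED RESTATEMENT S1′ of the SUPPLY crux 24276 (verbatim copy of `TURNKEY_route_edit_24277_onebit.lean`). -/
def CMPrimitiveSupplyAtInertTwoOneBitRestated : Prop :=
  ∀ (W : WeierstrassCurve ℚ) [W.IsElliptic] [W.IsGloballyMinimal] [NeZero (W.conductorNorm ℤ)], W.HasCM → Literature.NumberTheory.EllipticCurves.Rank1Residual.CMInert W 2 → W.HasSurjectiveModNGaloisRep (2 : ℤ) → W.analyticRank = 1 → Odd W.tamagawaProduct → (∃ Dt : Literature.NumberTheory.EllipticCurves.ModularForms.ModularParametrizationData W (W.conductorNorm ℤ), (∀ z ∈ Dt.L.lattice, ∃ w ∈ Literature.NumberTheory.EllipticCurves.ModularForms.periodLattice Dt.f, z = (Dt.c : ℂ) * w) ∧ Odd Dt.c) → ∃ (K : Type) (_ : Field K) (_ : NumberField K), Literature.NumberTheory.EllipticCurves.IsImaginaryQuadratic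 K ∧ Odd (NumberField.discr K) ∧ NumberField.discr K ≠ -3 ∧ Literature.NumberTheory.EllipticCurves.SatisfiesHeegnerHypothesis (W.conductorNorm ℤ) K ∧ (∑ q ∈ (NumberField.discr K).natAbs.primeFactors, ((if jacobiSym W.Δ.num q = -1 then 1 else 0) + (if jacobiSym W.Δ.num q = 1 ∧ Even (W.frobeniusTrace q) then 2 else 0)) ≤ 1) ∧ ¬ IsSquare ((NumberField.discr K : ℚ) * -|W.Δ|) ∧ ¬ IsSquare ((NumberField.discr K : ℚ) * (-(2 * |W.Δ|))) ∧ ∃ (Dt : Literature.NumberTheory.EllipticCurves.ModularForms.ModularParametrizationData W (W.conductorNorm ℤ)) (β : ℤ) (ι : K →+* ℂ) (d₁ : Literature.NumberTheory.EllipticCurves.KolyvaginHeegnerData Dt β ι 1), (∀ z ∈ Dt.L.lattice, ∃ w ∈ Literature.NumberTheory.EllipticCurves.ModularForms.periodLattice Dt.f, z = (Dt.c : ℂ) * w) ∧ Odd Dt.c ∧ ¬ IsOfFinAddOrder d₁.derivedPoint ∧ ∃ M₀ : ℕ, (∃ Q : (W.baseChange (Literature.NumberTheory.EllipticCurves.ringClassField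 K ι 1)).toAffine.Point, ((2 ^ M₀ : ℕ) : ℤ) • Q = d₁.derivedPoint) ∧ (¬ ∃ Q : (W.baseChange (Literature.NumberTheory.EllipticCurves.ringClassField K ι 1)).toAffine.Point, ((2 ^ (M₀ + 1) : ℕ) : ℤ) • Q = d₁.derivedPoint) ∧ ∃ (n : ℕ) (d : Literature.NumberTheory.EllipticCurves.KolyvaginHeegnerData Dt β ι n), Squarefree n ∧ (∀ ℓ ∈ n.primeFactors, (Literature.NumberTheory.EllipticCurves.Zhang2014.IsKolyvaginPrime (W.conductorNorm ℤ) W K 2 ℓ ∧ Literature.NumberTheory.EllipticCurves.Rank1Residual.CMInert W ℓ)) ∧ (¬ ∃ Q : (W.baseChange (Literature.NumberTheory.EllipticCurves.ringClassField K ι n)).toAffine.Point, (2 : ℤ) • Q = d.derivedPoint) ∧ ∃ (Wd : WeierstrassCurve ℚ) (_ : Wd.IsElliptic) (_ : Wd.IsGloballyMinimal), (∃ C : WeierstrassCurve.VariableChange ℚ, C • W.quadraticTwist (NumberField.discr K : ℚ) = Wd) ∧ Wd.HasCM ∧ Wd.analyticRank = 0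

/-- **THE DECIDING THEOREM, RE-CERTIFIED FOR R1′ + S1′**: same proof as today's `closes` (route file rev 18), the supplied field's `Σ ≤ 1`
feeding the restated exactness crux; all binders used. -/
theorem closes_onebit (hP : CMPrimitiveSupplyAtInertTwoOneBitRestated) (hXf : CMKolyvaginExactAtInertTwoOneBitRestatedOfFacts)
    (h37 : Prop37ReductionCongruenceInertAll) (hGf : CMExactDescentAtTwoOfFacts) (hR : OffHabitatCMResidualAtTwo) (hBF : CMRankZeroBSDTriple)
    (hL : EntireLFunctionRat) (hGZ : GrossZagierAllLevels) (hGZK : MultPublishedInputsAtTwo) (hMi : MilneAnyModel) :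
    Summit.BirchSwinnertonDyer.WAllCornerFTwo := by
  have hX : CMKolyvaginExactAtInertTwoOneBitRestated := hXf ⟨⟨hGZ, hGZK, hL, hMi⟩, h37⟩
  have hG : CMExactDescentAtTwo := hGf ⟨hGZ, hGZK, hL, hMi⟩
  intro W _ _ hcm hr
  haveI : NeZero (W.conductorNorm ℤ) := ⟨(W.conductorNorm_pos_holds).ne'⟩
  by_cases hH : (Literature.NumberTheory.EllipticCurves.Rank1Residual.CMInert W 2 ∧ W.HasSurjectiveModNGaloisRep (2 : ℤ) ∧
        Odd W.tamagawaProduct ∧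
        ∃ Dt : Literature.NumberTheory.EllipticCurves.ModularForms.ModularParametrizationData W (W.conductorNorm ℤ),
          (∀ z ∈ Dt.L.lattice, ∃ w ∈ Literature.NumberTheory.EllipticCurves.ModularForms.periodLattice Dt.f, z = (Dt.c : ℂ) * w) ∧ Odd Dt.c)
  · obtain ⟨hin, hρ, hT, hopt⟩ := hH
    obtain ⟨K, _, _, hIQ, hodd, h3, hHe, hdef, hsq1, hsq2, Dt, β, ι, d₁, hoptDt, hc, hy, M₀, hdiv, hndiv,
      n, d, hn, hKoly, hPn, Wd, _, _, hWd, hcmd, hrd⟩ := hP W hcm hin hρ hr hT hopt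
    have hex := hX W hcm hin hρ hT K hIQ hodd h3 hHe hdef hsq1 hsq2 Dt β ι d₁ hy M₀ hdiv hndiv n d hn hKoly hPn
    have hBd : Literature.NumberTheory.EllipticCurves.BSDp Wd 2 :=
      Summit.BirchSwinnertonDyer.Rank1Residual.bsdp_cm_rankZero (p := 2) hBF hL hcmd hrd
    exact hG W hcm hin hρ hr hT K hIQ hodd h3 hHe Dt hoptDt hc β ι d₁ hy M₀ hdiv hndiv hex Wd hWd hBd
  · exact hR W hcm hr hH

end Scratch.CMKolyvaginAtInertTwoClosesOneBit
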